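import Summits.Ventures.Crystal3D.Theorems.StickyWulffConstantGenericWallFloorBarlowTopFamily
import HarnessLib

/-!
# The ROW walker family of a Barlow plate: c-layer sites are FULL, row starts are valid, and CROSSING families are
# end-injective (crux `GenericWallFloor`, stmt-Ventures-19480, line `WallLedgerG`; lane T's row corner, cf-p1 DECISION (xxxvii⁗))

HONEST FRAMING. Venture `Summits/Ventures/Crystal3D` (cell `crystal3d-full`), helper `--supports` the crux `GenericWallFloor`
(stmt-Ventures-19480) of `route-Ventures-StickyWulffConstant`, registered line `WallLedgerG`, open stub `stub_twoSlabAdhesion`.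
Rung credit only; F-C1 not moved; NOT the stub.  First brick of the ROW F4 (`barlow_rowCount_le_payers`) lane T's row corner
consumes (wulff-p2 `…TexShadowRowSplitDefs`): the walker family launched along an IN-LAYER row direction `r` (a slot with `r₂ = 0`,
`r = α u + β v`) of a Barlow plate `(L, s₀, σ)`.

THE c-LAYER RESTRICTION (of record, p639545 `not_exactOnly_hcpInPlaneStar`): an in-layer walker is certified only from a FULL
predecessor, and a site of layer `k` is `L`-full exactly when `σ k = 1 = σ (k−1)` (a «++» c-layer: the nine non-negative slots land
in the Δ-bilayer `k, k+1`, the lower triangle in layer `k−1`).  Hence rows are paid ONLY in «++» layers of the given presentation.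

* `barlow_cc_full` — a «++» site around which the stacking is complete (every site within distance `1` occupied after the motion)
  is `L`-FULL;
* `rowStart_valid` — the 1-level row state `(L p + s₀, [⟨L, r, 0⟩])` at a site `p` whose row-predecessor `p − r` is such a site is
  valid: `WalkInv` (any unit steering `z` with `L r` `z`-steep), `StackWF`, bottom entry, strong certificate `WalkCertified12`;
* **`rowFamily_walkRun_injOn`** — a CROSSING family (start sites at `z`-height `≥ H` whose row-predecessors are full and lie strictly
  below `H`, pairwise distinct) is mapped injectively by `walkRun X z N`: a walker revisiting another start state would have
  stepped into it from the predecessor ball (a POP there is impossible, the predecessor being full — `false_of_full_of_pop`; a PUSH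
  leaves two levels), i.e. from below `H`, against the monotonicity of heights (`walkRun_height_ge`).  No prefix lemma, no sealing.
WHAT THIS IS NOT: not the family spec (ends ∈ PAY, reach set: next file), not the count; F-C1 not moved.
-/

noncomputable section

namespace Summit.Ventures.Crystal3D.Theorems

open Finset
open Literature.MathematicalPhysics.StatisticalMechanics
open scoped InnerProductSpace

variable {X : Finset (EuclideanSpace ℝ (Fin 3))}

/-! ### «++» c-layer sites are full -/

/-- Local completeness, unpacked: a stacking site within distance `1` of `p₀ = barlowPos σ k i j`, written `p₀ + d` with
`‖d‖ ≤ 1`, is occupied after the motion. -/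
theorem mem_of_site_near {σ : ℤ → ℤ} {L : EuclideanSpace ℝ (Fin 3) ≃ₗᵢ[ℝ] EuclideanSpace ℝ (Fin 3)}
    {s₀ : EuclideanSpace ℝ (Fin 3)} {k i j : ℤ}
    (hX : ∀ q ∈ barlowStacking 1 (Real.sqrt (2 / 3)) σ, dist q (barlowPos 1 (Real.sqrt (2 / 3)) σ k i j) ≤ 1 → L q + s₀ ∈ X)
    {m : ℤ} {d : EuclideanSpace ℝ (Fin 3)} (hd : ‖d‖ ≤ 1)
    (hmem : barlowPos 1 (Real.sqrt (2 / 3)) σ k i j + d ∈ barlowLayer 1 (Real.sqrt (2 / 3)) σ m) :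
    L (barlowPos 1 (Real.sqrt (2 / 3)) σ k i j) + s₀ + L d ∈ X := by
  have h := hX _ (barlowLayer_subset_stacking σ m hmem) (by rw [dist_comm, dist_self_add_right]; exact hd)
  rw [map_add] at h
  convert h using 1
  abel

/-- **A «++» c-layer site around which the stacking is complete is `L`-FULL** (`σ k = 1 = σ (k−1)`): the ball and its twelve
`L`-slots are occupied. -/
theorem barlow_cc_full (σ : ℤ → ℤ) (L : EuclideanSpace ℝ (Fin 3) ≃ₗᵢ[ℝ] EuclideanSpace ℝ (Fin 3)) (s₀ : EuclideanSpace ℝ (Fin 3))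
    (k i j : ℤ) (hk : σ k = 1) (hk' : σ (k - 1) = 1)
    (hX : ∀ q ∈ barlowStacking 1 (Real.sqrt (2 / 3)) σ, dist q (barlowPos 1 (Real.sqrt (2 / 3)) σ k i j) ≤ 1 → L q + s₀ ∈ X) :
    L (barlowPos 1 (Real.sqrt (2 / 3)) σ k i j) + s₀ ∈ X ∧
      ∀ w ∈ fccSlots, L (barlowPos 1 (Real.sqrt (2 / 3)) σ k i j) + s₀ + L w ∈ X := by
  refine ⟨?_, fun w hw => ?_⟩
  · have := hX _ (barlowPos_mem k i j) (by rw [dist_self]; norm_num)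
    exact this
  rcases slot_apply_two_cases hw with h | h | h
  · rcases barlow_delta_add_slot_mem σ k i j hk hw h.ge with h' | h'
    · exact mem_of_site_near hX (by rw [norm_eq_one_of_mem_fccSlots hw]) h'
    · exact mem_of_site_near hX (by rw [norm_eq_one_of_mem_fccSlots hw]) h'
  · rcases barlow_delta_add_slot_mem σ k i j hk hw (by rw [h]; exact Real.sqrt_nonneg _) with h' | h'
    · exact mem_of_site_near hX (by rw [norm_eq_one_of_mem_fccSlots hw]) h'
    · exact mem_of_site_near hX (by rw [norm_eq_one_of_mem_fccSlots hw]) h'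
  · exact mem_of_site_near hX (by rw [norm_eq_one_of_mem_fccSlots hw]) (barlow_delta_sub_slot_mem σ k i j hk' hw h)

/-! ### Row starts are valid -/

/-- **The row start state is valid.**  `r` a slot, `L r` steep for the unit steering `z`; the site `p` with its
row-predecessor `q = p − r` (so `L q + s₀ + L r = L p + s₀`) occupied together with its twelve `L`-slots.  Then the 1-level state
`(L p + s₀, [⟨L, r, 0⟩])` satisfies `WalkInv`, `StackWF`, has bottom entry `⟨L, r, 0⟩`, and carries `WalkCertified12`. -/
theorem rowStart_valid (L : EuclideanSpace ℝ (Fin 3) ≃ₗᵢ[ℝ] EuclideanSpace ℝ (Fin 3)) (s₀ : EuclideanSpace ℝ (Fin 3))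
    {r : EuclideanSpace ℝ (Fin 3)} (hr : r ∈ fccSlots) {z : EuclideanSpace ℝ (Fin 3)} (hsteep : Real.sqrt 2 / 2 ≤ ⟪L r, z⟫_ℝ)
    {p q : EuclideanSpace ℝ (Fin 3)} (hpq : q + r = p)
    (hq : L q + s₀ ∈ X) (hfull : ∀ w ∈ fccSlots, L q + s₀ + L w ∈ X) :
    WalkInv X z (L p + s₀, [⟨L, r, 0⟩]) ∧ StackWF z ([⟨L, r, 0⟩] : List WalkEntry) ∧
      ([⟨L, r, 0⟩] : List WalkEntry).getLast? = some ⟨L, r, 0⟩ ∧ WalkCertified12 X (L p + s₀) ⟨L, r, 0⟩ := by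
  have hpos : L q + s₀ + L r = L p + s₀ := by rw [← hpq, map_add]; abel
  refine ⟨?_, stackWF_start z L r, rfl, ?_⟩
  · have h := walkInv_start L hq hfull hr hsteep
    rwa [hpos] at h
  · have h := walkCertified12_of_full L (q := r) (m := 0) hq hfull
    rwa [hpos] at h

/-! ### Crossing families are end-injective -/

/-- **A row walker never visits another crossing start.**  Starts `st i = (L (p i) + s₀, [⟨L, r, 0⟩])` at `z`-height `≥ H`,
row-predecessors `p i − r` FULL and strictly below `H`; if the run from `st i` is at time `k` in the state `st j`, then the
start BALLS coincide (`p i = p j`). -/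
theorem rowFamily_orbit (hX : ∀ p ∈ X, ∀ q ∈ X, p ≠ q → 1 ≤ dist p q)
    {s₁ : EuclideanSpace ℝ (Fin 3)} (hs₁ : s₁ ∈ fccSlots) (hcert : ExactOnly 0 (fccSlots.filter fun w => 0 < ⟪w, s₁⟫_ℝ))
    {z : EuclideanSpace ℝ (Fin 3)} (hz : ‖z‖ = 1)
    (L : EuclideanSpace ℝ (Fin 3) ≃ₗᵢ[ℝ] EuclideanSpace ℝ (Fin 3)) (s₀ : EuclideanSpace ℝ (Fin 3))
    {r : EuclideanSpace ℝ (Fin 3)} (hr : r ∈ fccSlots) (hsteep : Real.sqrt 2 / 2 ≤ ⟪L r, z⟫_ℝ)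
    {ι : Type*} (T : Finset ι) (p : ι → EuclideanSpace ℝ (Fin 3))
    (hfullpred : ∀ i ∈ T, L (p i - r) + s₀ ∈ X ∧ ∀ w ∈ fccSlots, L (p i - r) + s₀ + L w ∈ X)
    (H : ℝ) (hlow : ∀ i ∈ T, H ≤ ⟪L (p i) + s₀, z⟫_ℝ) (hpred : ∀ i ∈ T, ⟪L (p i - r) + s₀, z⟫_ℝ < H)
    {i j : ι} (hi : i ∈ T) (hj : j ∈ T) :
    ∀ k : ℕ, walkRun X z k (L (p i) + s₀, [⟨L, r, 0⟩]) = (L (p j) + s₀, [⟨L, r, 0⟩]) → p i = p j := by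
  intro k
  induction k with
  | zero =>
    intro h
    rw [walkRun_zero] at h
    have h1 : L (p i) + s₀ = L (p j) + s₀ := (Prod.mk.inj h).1
    exact L.injective (add_right_cancel h1)
  | succ k IH =>
    intro h
    obtain ⟨hI₀, hW₀, -, -⟩ := rowStart_valid L s₀ hr hsteep (sub_add_cancel (p i) r) (hfullpred i hi).1 (hfullpred i hi).2
    rw [walkRun_succ'] at h
    obtain ⟨hwI, hwW⟩ := walkRun_valid hX hs₁ hcert hz k hI₀ hW₀
    have hmono := walkRun_height_ge hX hs₁ hcert hz k _ hI₀
    rcases hws : walkRun X z k (L (p i) + s₀, [⟨L, r, 0⟩]) with ⟨yw, stk⟩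
    rw [hws] at h hwI hwW hmono
    cases hstep : walkStep X z (yw, stk) with
    | none =>
      rw [walkRun_succ_of_none X z 0 hstep] at h
      exact IH (hws.trans h)
    | some v =>
      rw [walkRun_succ_of_some X z 0 hstep, walkRun_zero] at h
      subst h
      obtain ⟨-, hSw, ew, rw', hstk, -⟩ := hwI
      simp only at hstk hSw hmono
      subst hstk
      -- the predecessor ball of the start `j`
      have hqfull := (hfullpred j hj).2
      have hqpos : L (p j - r) + s₀ + L r = L (p j) + s₀ := by rw [map_sub]; abel
      rcases walkStep_cases hstep with ⟨-, hs⟩ | ⟨n, hcap, ⟨e', rest', hrr, hn, hs⟩ | ⟨-, hs⟩⟩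
      · -- FULL: the walker stood on the predecessor ball, below `H` — against monotone heights
        exfalso
        injection hs with hy hl
        injection hl with hew hrw
        subst hew
        have hy' : yw + L r = L (p j) + s₀ := by first | exact hy | exact hy.symm
        have hyw : yw = L (p j - r) + s₀ := by
          rw [← hqpos] at hy'; exact add_right_cancel hy'
        rw [hyw] at hmono
        linarith [hlow i hi, hpred j hj]
      · -- POP: the predecessor ball would be an exact cap of the twin frame, but it is full
        exfalso
        subst hrr
        injection hs with hy hl
        injection hl with he' hrest
        subst he'
        have hy' : yw + L r = L (p j) + s₀ := by first | exact hy | exact hy.symm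
        have hyw : yw = L (p j - r) + s₀ := by
          rw [← hqpos] at hy'; exact add_right_cancel hy'
        subst hn
        obtain ⟨hSo, hLi, -⟩ := hSw
        rw [hyw] at hcap
        exact false_of_full_of_pop hX hSo hLi hcap hqfull
      · -- PUSH: the stack would have two levels
        exfalso
        rw [pushMove_eq] at hs
        injection hs with _ hl
        injection hl with _ hl'
        first | exact List.cons_ne_nil _ _ hl' | exact List.cons_ne_nil _ _ hl'.symm

/-- **Crossing row families are end-injective.**  Under the hypotheses of `rowFamily_orbit` and with pairwise distinct start
sites (`hinjT`), `i ↦ walkRun X z N (L (p i) + s₀, [⟨L, r, 0⟩])` is injective on `T` (every `N`). -/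
theorem rowFamily_walkRun_injOn (hX : ∀ p ∈ X, ∀ q ∈ X, p ≠ q → 1 ≤ dist p q)
    {s₁ : EuclideanSpace ℝ (Fin 3)} (hs₁ : s₁ ∈ fccSlots) (hcert : ExactOnly 0 (fccSlots.filter fun w => 0 < ⟪w, s₁⟫_ℝ))
    {z : EuclideanSpace ℝ (Fin 3)} (hz : ‖z‖ = 1)
    (L : EuclideanSpace ℝ (Fin 3) ≃ₗᵢ[ℝ] EuclideanSpace ℝ (Fin 3)) (s₀ : EuclideanSpace ℝ (Fin 3))
    {r : EuclideanSpace ℝ (Fin 3)} (hr : r ∈ fccSlots) (hsteep : Real.sqrt 2 / 2 ≤ ⟪L r, z⟫_ℝ)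
    {ι : Type*} (T : Finset ι) (p : ι → EuclideanSpace ℝ (Fin 3))
    (hfullpred : ∀ i ∈ T, L (p i - r) + s₀ ∈ X ∧ ∀ w ∈ fccSlots, L (p i - r) + s₀ + L w ∈ X)
    (H : ℝ) (hlow : ∀ i ∈ T, H ≤ ⟪L (p i) + s₀, z⟫_ℝ) (hpred : ∀ i ∈ T, ⟪L (p i - r) + s₀, z⟫_ℝ < H)
    (hinjT : ∀ i ∈ T, ∀ j ∈ T, p i = p j → i = j) (N : ℕ) :
    ∀ i ∈ T, ∀ j ∈ T,
      walkRun X z N (L (p i) + s₀, [⟨L, r, 0⟩]) = walkRun X z N (L (p j) + s₀, [⟨L, r, 0⟩]) → i = j :=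
  walkRun_injOn_of_orbitFree hX hs₁ hcert hz T (fun i => (L (p i) + s₀, [⟨L, r, 0⟩]))
    (fun i hi => by
      obtain ⟨hI, hW, -, -⟩ := rowStart_valid L s₀ hr hsteep (sub_add_cancel (p i) r) (hfullpred i hi).1 (hfullpred i hi).2
      exact ⟨hI, hW⟩)
    (fun i hi j hj hij k hk => hij (hinjT i hi j hj
      (rowFamily_orbit hX hs₁ hcert hz L s₀ hr hsteep T p hfullpred H hlow hpred hi hj k hk))) N

end Summit.Ventures.Crystal3D.Theorems

end
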